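import Mathlib
import Literature.Combinatorics.Hinz2018.IrregularToRegular

/-!
# Out-degrees of the mixed graph `\vec H_3^n` (Hinz–Klavžar–Petr 2018, Ch. 3 §3.1 p. 166)

[cite: HinzKlavzarPetr2018, Ch. 3 §3.1 pp. 166–167; Exercise 5.9, solution Ch. 9 pp. 382–383]

The book's digraph `\vec H_3^n` on the states `𝔗^n` has an arc `(σ, τ)` when `τ` results from
`σ` «by a legal move of one disc»; «some of the edges must be oriented». Figure 3.2 draws it for
`n = 2, 3`. The sibling `IrregularToRegular` types the arcs (`step`, `succs`); the census file
counts, by kernel computation, 18 states of `𝔗^3` with two legal moves and 42 with three.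

The count behind those numbers is the argument of the solution of Exercise 5.9 (Ch. 9,
pp. 382–383), given there for the REGULAR states of `H_p^n` with `k` non-empty pegs: there are
`k(p-k)` «legal moves between non-empty and empty pegs» and «between two non-empty pegs, exactly
one move is legal», degree `k(p-k) + (k choose 2)`. The argument only looks at the top discs, so
it holds verbatim for irregular states; at `p = 3` it gives out-degree 2, 3, 3 in `\vec H_3^n`
for `k = 1, 2, 3`. The book does not state the irregular case; the tree types the regular one
(`HanoiGraphsHpLegalMoves.card_legalMovesP_eq`, states as maps `Fin n → Fin p`). This file types
the mixed-graph case over the sibling's `IState` / `succs` (ours): out of any three stacks at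
most 3 moves are legal (`length_succs_le_three`); none out of the empty state, exactly 2 when
all discs lie on one peg (`length_succs_of_onePeg`), exactly 3 otherwise as soon as the discs
are pairwise distinct (`length_succs_of_twoPegs`); the closed formula `length_succs_eq`; for the
states of `𝔗^n`, `n ≠ 0`, out-degree 2 or 3 (`length_succs_of_isState`, `two_le_length_succs`).
Finite shadow (kernel check, Figure 3.2): in `𝔗^3` the two-move states are exactly the one-peg
states, 18 = 3·3! of them, and 72 = 3·4! in `𝔗^4` (the census file's 18 and 72).

NOT TYPED (candidates, ours): the closed forms that follow by summation over `𝔗^n` — arcs of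
`\vec H_3^n` number `3·|𝔗^n| - 3·n!`, one-peg states `3·n!` for every `n`, edges = states.
-/

namespace Literature.Combinatorics.Hinz2018
namespace IrregularMixedGraphDegrees

open IrregularToRegular

/-- The empty state has no move.
[cite: HinzKlavzarPetr2018, Ch. 3 §3.1 p. 166; Exercise 5.9, solution Ch. 9 pp. 382–383 (ours)] -/
theorem succs_empty : succs ⟨[], [], []⟩ = [] := by rfl

/-- All discs on ONE peg: exactly two legal moves (the top disc to either empty peg).
[cite: HinzKlavzarPetr2018, Ch. 3 §3.1 p. 166; Exercise 5.9, solution Ch. 9 pp. 382–383 (ours)] -/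
theorem length_succs_of_onePeg (σ : IState) (hσ : σ.discs ≠ [])
    (h : (σ.p1 = [] ∧ σ.p2 = []) ∨ (σ.p0 = [] ∧ σ.p2 = []) ∨ (σ.p0 = [] ∧ σ.p1 = [])) :
    (succs σ).length = 2 := by
  obtain ⟨p0, p1, p2⟩ := σ
  simp only [IState.discs] at hσ
  rcases h with ⟨h1, h2⟩ | ⟨h1, h2⟩ | ⟨h1, h2⟩ <;> simp only at h1 h2 <;> subst h1 h2 <;>
    simp only [List.append_nil, List.nil_append, ne_eq] at hσ <;>
    obtain ⟨a, l, rfl⟩ := List.exists_cons_of_ne_nil hσ <;>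
    simp [succs, movePairs, step, IState.stack, IState.set, canPlace, List.filterMap,
      (by decide : (0 : ZMod 3) ≠ 1), (by decide : (0 : ZMod 3) ≠ 2),
      (by decide : (1 : ZMod 3) ≠ 0), (by decide : (1 : ZMod 3) ≠ 2),
      (by decide : (2 : ZMod 3) ≠ 0), (by decide : (2 : ZMod 3) ≠ 1)]

/-- Discs on at least TWO pegs, pairwise distinct: exactly three legal moves.
[cite: HinzKlavzarPetr2018, Ch. 3 §3.1 p. 166; Exercise 5.9, solution Ch. 9 pp. 382–383 (ours)] -/
theorem length_succs_of_twoPegs (σ : IState) (hnd : σ.discs.Nodup)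
    (h : ¬ ((σ.p1 = [] ∧ σ.p2 = []) ∨ (σ.p0 = [] ∧ σ.p2 = []) ∨ (σ.p0 = [] ∧ σ.p1 = []))) :
    (succs σ).length = 3 := by
  obtain ⟨p0, p1, p2⟩ := σ
  simp only [IState.discs] at hnd
  simp only at h
  rcases p0 with _ | ⟨a, l⟩ <;> rcases p1 with _ | ⟨b, l'⟩ <;> rcases p2 with _ | ⟨c, l''⟩ <;>
    simp at h
  · have hbc : b ≠ c := by rintro rfl; simp at hnd
    rcases Nat.lt_or_gt_of_ne hbc with h1 | h1 <;>
      simp [succs, movePairs, step, IState.stack, IState.set, canPlace, List.filterMap, h1,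
        Nat.lt_asymm h1, (by decide : (0 : ZMod 3) ≠ 1), (by decide : (0 : ZMod 3) ≠ 2),
        (by decide : (1 : ZMod 3) ≠ 0), (by decide : (1 : ZMod 3) ≠ 2),
        (by decide : (2 : ZMod 3) ≠ 0), (by decide : (2 : ZMod 3) ≠ 1)]
  · have hac : a ≠ c := by rintro rfl; simp at hnd
    rcases Nat.lt_or_gt_of_ne hac with h1 | h1 <;>
      simp [succs, movePairs, step, IState.stack, IState.set, canPlace, List.filterMap, h1,
        Nat.lt_asymm h1, (by decide : (0 : ZMod 3) ≠ 1), (by decide : (0 : ZMod 3) ≠ 2),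
        (by decide : (1 : ZMod 3) ≠ 0), (by decide : (1 : ZMod 3) ≠ 2),
        (by decide : (2 : ZMod 3) ≠ 0), (by decide : (2 : ZMod 3) ≠ 1)]
  · have hab : a ≠ b := by rintro rfl; simp at hnd
    rcases Nat.lt_or_gt_of_ne hab with h1 | h1 <;>
      simp [succs, movePairs, step, IState.stack, IState.set, canPlace, List.filterMap, h1,
        Nat.lt_asymm h1, (by decide : (0 : ZMod 3) ≠ 1), (by decide : (0 : ZMod 3) ≠ 2),
        (by decide : (1 : ZMod 3) ≠ 0), (by decide : (1 : ZMod 3) ≠ 2),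
        (by decide : (2 : ZMod 3) ≠ 0), (by decide : (2 : ZMod 3) ≠ 1)]
  · have hab : a ≠ b := by rintro rfl; simp at hnd
    have hac : a ≠ c := by rintro rfl; simp at hnd
    have hbc : b ≠ c := by rintro rfl; simp [List.nodup_append] at hnd
    rcases Nat.lt_or_gt_of_ne hab with h1 | h1 <;> rcases Nat.lt_or_gt_of_ne hac with h2 | h2 <;>
      rcases Nat.lt_or_gt_of_ne hbc with h3 | h3 <;>
      simp [succs, movePairs, step, IState.stack, IState.set, canPlace, List.filterMap,
        h1, h2, h3, Nat.lt_asymm h1, Nat.lt_asymm h2, Nat.lt_asymm h3,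
        (by decide : (0 : ZMod 3) ≠ 1), (by decide : (0 : ZMod 3) ≠ 2),
        (by decide : (1 : ZMod 3) ≠ 0), (by decide : (1 : ZMod 3) ≠ 2),
        (by decide : (2 : ZMod 3) ≠ 0), (by decide : (2 : ZMod 3) ≠ 1)]

/-- The out-degree of a state with pairwise distinct discs: 0 for the empty state, 2 when all
discs lie on one peg, 3 otherwise (ours).
[cite: HinzKlavzarPetr2018, Ch. 3 §3.1 p. 166; Exercise 5.9, solution Ch. 9 pp. 382–383 (ours)] -/
theorem length_succs_eq (σ : IState) (hnd : σ.discs.Nodup) :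
    (succs σ).length = if σ.discs = [] then 0 else
      if (σ.p1 = [] ∧ σ.p2 = []) ∨ (σ.p0 = [] ∧ σ.p2 = []) ∨ (σ.p0 = [] ∧ σ.p1 = []) then 2
      else 3 := by
  split_ifs with h0 h1
  · obtain ⟨p0, p1, p2⟩ := σ
    simp only [IState.discs, List.append_eq_nil_iff] at h0
    obtain ⟨⟨rfl, rfl⟩, rfl⟩ := h0
    rfl
  · exact length_succs_of_onePeg σ h0 h1
  · exact length_succs_of_twoPegs σ hnd h1

/-- Out of ANY three stacks at most three moves are legal (no distinctness needed).
[cite: HinzKlavzarPetr2018, Ch. 3 §3.1 p. 166; Exercise 5.9, solution Ch. 9 pp. 382–383 (ours)] -/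
theorem length_succs_le_three (σ : IState) : (succs σ).length ≤ 3 := by
  obtain ⟨p0, p1, p2⟩ := σ
  rcases p0 with _ | ⟨a, l⟩ <;> rcases p1 with _ | ⟨b, l'⟩ <;> rcases p2 with _ | ⟨c, l''⟩
  · decide
  · simp [succs, movePairs, step, IState.stack, IState.set, canPlace, List.filterMap,
      (by decide : (0 : ZMod 3) ≠ 1), (by decide : (0 : ZMod 3) ≠ 2),
      (by decide : (1 : ZMod 3) ≠ 0), (by decide : (1 : ZMod 3) ≠ 2),
      (by decide : (2 : ZMod 3) ≠ 0), (by decide : (2 : ZMod 3) ≠ 1)]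
  · simp [succs, movePairs, step, IState.stack, IState.set, canPlace, List.filterMap,
      (by decide : (0 : ZMod 3) ≠ 1), (by decide : (0 : ZMod 3) ≠ 2),
      (by decide : (1 : ZMod 3) ≠ 0), (by decide : (1 : ZMod 3) ≠ 2),
      (by decide : (2 : ZMod 3) ≠ 0), (by decide : (2 : ZMod 3) ≠ 1)]
  · by_cases h1 : b < c <;> by_cases h2 : c < b <;>
      simp [succs, movePairs, step, IState.stack, IState.set, canPlace, List.filterMap, h1, h2,
        (by decide : (0 : ZMod 3) ≠ 1), (by decide : (0 : ZMod 3) ≠ 2),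
        (by decide : (1 : ZMod 3) ≠ 0), (by decide : (1 : ZMod 3) ≠ 2),
        (by decide : (2 : ZMod 3) ≠ 0), (by decide : (2 : ZMod 3) ≠ 1)]
    all_goals omega
  · simp [succs, movePairs, step, IState.stack, IState.set, canPlace, List.filterMap,
      (by decide : (0 : ZMod 3) ≠ 1), (by decide : (0 : ZMod 3) ≠ 2),
      (by decide : (1 : ZMod 3) ≠ 0), (by decide : (1 : ZMod 3) ≠ 2),
      (by decide : (2 : ZMod 3) ≠ 0), (by decide : (2 : ZMod 3) ≠ 1)]
  · by_cases h1 : a < c <;> by_cases h2 : c < a <;>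
      simp [succs, movePairs, step, IState.stack, IState.set, canPlace, List.filterMap, h1, h2,
        (by decide : (0 : ZMod 3) ≠ 1), (by decide : (0 : ZMod 3) ≠ 2),
        (by decide : (1 : ZMod 3) ≠ 0), (by decide : (1 : ZMod 3) ≠ 2),
        (by decide : (2 : ZMod 3) ≠ 0), (by decide : (2 : ZMod 3) ≠ 1)]
    all_goals omega
  · by_cases h1 : a < b <;> by_cases h2 : b < a <;>
      simp [succs, movePairs, step, IState.stack, IState.set, canPlace, List.filterMap, h1, h2,
        (by decide : (0 : ZMod 3) ≠ 1), (by decide : (0 : ZMod 3) ≠ 2),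
        (by decide : (1 : ZMod 3) ≠ 0), (by decide : (1 : ZMod 3) ≠ 2),
        (by decide : (2 : ZMod 3) ≠ 0), (by decide : (2 : ZMod 3) ≠ 1)]
    all_goals omega
  · by_cases h1 : a < b <;> by_cases h2 : b < a <;> by_cases h3 : a < c <;> by_cases h4 : c < a <;>
      by_cases h5 : b < c <;> by_cases h6 : c < b <;>
      simp [succs, movePairs, step, IState.stack, IState.set, canPlace, List.filterMap,
        h1, h2, h3, h4, h5, h6,
        (by decide : (0 : ZMod 3) ≠ 1), (by decide : (0 : ZMod 3) ≠ 2),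
        (by decide : (1 : ZMod 3) ≠ 0), (by decide : (1 : ZMod 3) ≠ 2),
        (by decide : (2 : ZMod 3) ≠ 0), (by decide : (2 : ZMod 3) ≠ 1)] <;> omega

/-- Every state of `𝔗^n` with `n ≠ 0` has out-degree 2 (all discs on one peg) or 3 (ours; the
general form of the 18 / 42 split of `𝔗^3` in Figure 3.2).
[cite: HinzKlavzarPetr2018, Ch. 3 §3.1 p. 166; Exercise 5.9, solution Ch. 9 pp. 382–383 (ours)] -/
theorem length_succs_of_isState {n : ℕ} {σ : IState} (h : IsState n σ) (hn : n ≠ 0) :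
    (succs σ).length =
      if (σ.p1 = [] ∧ σ.p2 = []) ∨ (σ.p0 = [] ∧ σ.p2 = []) ∨ (σ.p0 = [] ∧ σ.p1 = []) then 2
      else 3 := by
  have hnd : σ.discs.Nodup := h.nodup_iff.2 (List.nodup_range' (s := 1) (n := n))
  have hne : σ.discs ≠ [] := by
    intro he
    have hl := h.length_eq
    rw [he] at hl
    simp at hl
    omega
  rw [length_succs_eq σ hnd, if_neg hne]

/-- Hence `2 ≤ out-degree ≤ 3` on `𝔗^n`, `n ≠ 0` (ours).
[cite: HinzKlavzarPetr2018, Ch. 3 §3.1 p. 166; Exercise 5.9, solution Ch. 9 pp. 382–383 (ours)] -/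
theorem two_le_length_succs {n : ℕ} {σ : IState} (h : IsState n σ) (hn : n ≠ 0) :
    2 ≤ (succs σ).length ∧ (succs σ).length ≤ 3 := by
  rw [length_succs_of_isState h hn]
  split_ifs <;> simp

/-- Finite shadow (Figure 3.2, kernel check): in `𝔗^3` the two-move states are exactly the
one-peg states; they number 18 = 3·3!, and 72 = 3·4! in `𝔗^4` (the census file's 18 / 72).
[cite: HinzKlavzarPetr2018, Ch. 3 §3.1 pp. 166–167 (Figure 3.2; exhaustive checks, ours)] -/
theorem figure_3_2_twoMove_iff_onePeg :
    (∀ σ ∈ allStates 3, (succs σ).length = 2 ↔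
      (σ.p1 = [] ∧ σ.p2 = []) ∨ (σ.p0 = [] ∧ σ.p2 = []) ∨ (σ.p0 = [] ∧ σ.p1 = [])) ∧
    ((allStates 3).filter fun σ =>
      (σ.p1 = [] ∧ σ.p2 = []) ∨ (σ.p0 = [] ∧ σ.p2 = []) ∨ (σ.p0 = [] ∧ σ.p1 = [])).length =
      3 * Nat.factorial 3 ∧
    ((allStates 4).filter fun σ =>
      (σ.p1 = [] ∧ σ.p2 = []) ∨ (σ.p0 = [] ∧ σ.p2 = []) ∨ (σ.p0 = [] ∧ σ.p1 = [])).length =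
      3 * Nat.factorial 4 := by
  refine ⟨by decide +kernel, by decide +kernel, by decide +kernel⟩

end IrregularMixedGraphDegrees
end Literature.Combinatorics.Hinz2018
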